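import Literature.Probability.RandomPlanarGeometry.SAWRatioRateEnvelope
import Literature.Probability.RandomPlanarGeometry.SAWEndpointRateLowerInsertion
import Literature.Probability.RandomPlanarGeometry.HexSAWHammersleyWelshLog
import Literature.Probability.RandomPlanarGeometry.HexSAWRatioLimit
import HarnessLib

/-!
# A rate in Kesten's two-step ratio limit theorem on the hexagonal lattice:
# `−K N^{-1/4} ≤ c_{N+2}(ℍ)/c_N(ℍ) − (2 + √2) ≤ K N^{-1/3}`

Topic `Literature/Probability/RandomPlanarGeometry`. Sources: N. Madras, G. Slade, *The Self-Avoiding Walk* (1993),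
§7.3, Lemma 7.3.1 (the iteration of `φ_{N+2} ≥ φ_N − B/N`, (7.3.3)) and §7.5, eq. (7.5.1) (Kesten's rate
`|c_{N+2}/c_N − μ²| ≤ K N^{-1/3}` on `ℤ^d`, H. Kesten, J. Math. Phys. 4 (1963) 960–969, printed without proof);
H. Duminil-Copin, S. Smirnov, Ann. of Math. 175 (2012), Theorem 1 (`μ_ℍ = √(2+√2)`, tree theorem
`DuminilCopinSmirnov2012_thm1_holds`). Lane «pcv-sawmu», bet A2 «HEX-RATIO-2», rider «HEX-RATIO-2-RATE».

The lattice-free layer `SAWRatioRateEnvelope.lean` (`Zd.KestenRateEnv.*`: the tree's quantitative Lemma 7.3.1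
`Zd.KestenRate.upper_dev` / `lower_dev` and the cube-root engine `Zd.KestenRateUpper.upper_rate_cubeRoot_sub`) is
run on `c_n = c_n(ℍ)` with the all-`n` Hammersley–Welsh-type envelope `c_n(ℍ) ≤ 24 e^{17800 √n} μ_ℍ^n` (from
`hexHWLogStretched_numeral`), submultiplicativity `hexSawCount_add_le`, Kesten's two-step inequality (7.3.4) on `ℍ`
(hypothesis `hK`, the body of the H-BASE face `SAW.HV.KestenIneqHex`) and `c_N ≤ c_{N+4}` (hypothesis `h3`, the
body of the K3-ℍ face `HexPlusFour`):

* `HexRate.hexSawCount_le_envelope` — `c_n(ℍ) ≤ 24 e^{17800 √n} μ_ℍ^n` for EVERY `n`;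
* `HexRate.kesten733_hex` — (7.3.4) eventually + `1/9 ≤ φ_N ≤ 9` ⇒ (7.3.3) for all `n ≥ 1` with some `B ≥ 5μ_ℍ²`;
* **`hexRatioTwo_rate_of h3 hK : ∃ K, ∀ N ≥ 1, |c_{N+2}(ℍ)/c_N(ℍ) − (2+√2)| ≤ K · N^{-1/4}`**;
* **`hexRatioTwo_rate_mixed_of h3 hK : ∃ K, ∀ N ≥ 1, −K N^{-1/4} ≤ c_{N+2}(ℍ)/c_N(ℍ) − (2+√2) ≤ K N^{-1/3}`**;
* UNCONDITIONAL **`hexRatioTwo_rate`**, **`hexRatioTwo_rate_mixed`**: the same fed by the tree theorems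
  `hexSawCount_le_add_four` (K3-ℍ, `HexSAWPlusFour`) and `HV.KestenIneqHex_holds` (HEX FINAL, `HexSAWRatioLimit`).
* `hexRatioTwo_rate_cubeRoot_of` — the two-sided `N^{-1/3}` rate MODULO an insertion inequality
  `c_n(ℍ) · e_M ≤ (n+1) · c_{n+2M}(ℍ)` and a lower envelope `e^{-c√M} μ_ℍ^{2M} ≤ A e_M` for an auxiliary count `e`
  (the lane's route R72: `e_M` = brick-wall bridges of length `2M`), by the tree's `Zd.KestenRateLower.lower_rate_cubeRoot_ins`.

Exponents: `1/4` below is the price of using only the Hammersley–Welsh-type envelope as a-priori input (the TREE's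
proof of (7.5.1) on `ℤ^d`, `Zd.Kesten1963_ratioRate_holds`, gets `1/3` below from a polygon-concatenation lower
envelope in the role of Madras–Slade Corollary 3.2.6, (3.2.10), p. 68 (proof pp. 68–69), which the tree lacks for `ℍ`); `1/3` above by submultiplicativity at the
short length. Nothing is printed for `ℍ`: Madras–Slade (7.5.1)–(7.5.2), p. 255, are `ℤ^d` statements, given without
proof, «due to Kesten (1963)»; Duminil-Copin–Smirnov give `μ_ℍ`, not ratio asymptotics.
-/

noncomputable section

open Filter Topology Finset

namespace Literature.Probability.RandomPlanarGeometry.SAW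

namespace HexRate

/-- `μ_ℍ = √(2+√2)`, `1 ≤ μ_ℍ`, `μ_ℍ² = 2 + √2`. [cite: DuminilCopinSmirnov2012, Thm 1] -/
theorem hexConnectiveConstant_facts :
    hexConnectiveConstant = Real.sqrt (2 + Real.sqrt 2) ∧ 1 ≤ hexConnectiveConstant ∧
      hexConnectiveConstant ^ 2 = 2 + Real.sqrt 2 := by
  have hhex : hexConnectiveConstant = Real.sqrt (2 + Real.sqrt 2) :=
    hexConnectiveConstant_eq_of_thm1 DuminilCopinSmirnov2012_thm1_holds
  have hsq : hexConnectiveConstant ^ 2 = 2 + Real.sqrt 2 := by rw [hhex, Real.sq_sqrt (by positivity)]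
  refine ⟨hhex, ?_, hsq⟩
  have h2 : (1 : ℝ) ≤ 2 + Real.sqrt 2 := by have := Real.sqrt_nonneg 2; linarith
  rw [hhex, Real.le_sqrt (by norm_num) (by positivity)]
  simpa using h2

/-- **All-`n` Hammersley–Welsh envelope on `ℍ`**: `c_n(ℍ) ≤ 24 e^{17800 √n} μ_ℍ^n` for every `n` (from
`hexHWLogStretched_numeral` for `n ≥ 3`, where `(log n)^{-1/6} ≤ 1`; `c_0 = 1`, `c_1 ≤ 3`, `c_2 ≤ 9` directly).
[cite: GlazmanManolescu2019, Proposition 1.1 (HW-type envelope on `ℍ`; the numerals 24, 17800 are the lane's `hexHWLogStretched_numeral`)] -/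
theorem hexSawCount_le_envelope (n : ℕ) :
    (hexSawCount n : ℝ) ≤ 24 * Real.exp (17800 * Real.sqrt n) * hexConnectiveConstant ^ n := by
  obtain ⟨-, hμ1, -⟩ := hexConnectiveConstant_facts
  have hμn : 1 ≤ hexConnectiveConstant ^ n := one_le_pow₀ hμ1
  have he1 : 1 ≤ Real.exp (17800 * Real.sqrt n) := Real.one_le_exp (by positivity)
  rcases Nat.lt_or_ge n 3 with hn | hn
  · have hc : (hexSawCount n : ℝ) ≤ 9 := by
      interval_cases n
      · rw [hexSawCount_zero]; norm_num
      · have := hexSawCount_one_le; exact_mod_cast this.trans (by norm_num)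
      · exact_mod_cast hexSawCount_two_le
    calc (hexSawCount n : ℝ) ≤ 9 := hc
      _ ≤ 24 * 1 * 1 := by norm_num
      _ ≤ 24 * Real.exp (17800 * Real.sqrt n) * hexConnectiveConstant ^ n :=
          mul_le_mul (mul_le_mul_of_nonneg_left he1 (by norm_num)) hμn (by norm_num) (by positivity)
  · have h := hexHWLogStretched_numeral n (by omega)
    have hlog : 1 ≤ Real.log n := by
      have h3 : (3 : ℝ) ≤ n := by exact_mod_cast hn
      have he : Real.exp 1 ≤ 3 := by have := Real.exp_one_lt_d9; linarith
      calc (1 : ℝ) = Real.log (Real.exp 1) := (Real.log_exp 1).symm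
        _ ≤ Real.log n := Real.log_le_log (Real.exp_pos 1) (he.trans h3)
    have hr : (Real.log n) ^ (-(1 : ℝ) / 6) ≤ 1 :=
      Real.rpow_le_one_of_one_le_of_nonpos hlog (by norm_num)
    have hr0 : 0 ≤ (Real.log n) ^ (-(1 : ℝ) / 6) := Real.rpow_nonneg (by linarith) _
    have hexp2 : Real.exp (17800 * Real.sqrt n * (Real.log n) ^ (-(1 : ℝ) / 6)) ≤
        Real.exp (17800 * Real.sqrt n) := by
      apply Real.exp_le_exp.2
      have : 0 ≤ 17800 * Real.sqrt n := by positivity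
      nlinarith
    calc (hexSawCount n : ℝ)
        ≤ 24 * Real.exp (17800 * Real.sqrt n * (Real.log n) ^ (-(1 : ℝ) / 6)) * hexConnectiveConstant ^ n := h
      _ ≤ 24 * Real.exp (17800 * Real.sqrt n) * hexConnectiveConstant ^ n :=
          mul_le_mul_of_nonneg_right (mul_le_mul_of_nonneg_left hexp2 (by norm_num)) (by positivity)

/-- `c_{n+2}(ℍ) ≤ 9 c_n(ℍ)` (`c_{n+2} ≤ c_n c_2`, `c_2 ≤ 9`). [cite: DuminilCopinSmirnov2012, §1 (`c_{n+m} ≤ c_n c_m`)] -/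
theorem hexSawCount_add_two_le (n : ℕ) : (hexSawCount (n + 2) : ℝ) ≤ 9 * hexSawCount n := by
  have h1 : (hexSawCount (n + 2) : ℝ) ≤ hexSawCount n * hexSawCount 2 := by exact_mod_cast hexSawCount_add_le n 2
  have h2 : (hexSawCount 2 : ℝ) ≤ 9 := by exact_mod_cast hexSawCount_two_le
  have h0 : (0 : ℝ) ≤ hexSawCount n := Nat.cast_nonneg _
  nlinarith

/-- Under `c_N ≤ c_{N+4}`: `c_n(ℍ) ≤ 9 c_{n+2}(ℍ)`, i.e. `φ_n ≥ 1/9` (the lane's substitute for Madras–Slade's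
(7.1.5) `c_N ≤ c_{N+2}` on `ℤ^d`). [cite: MadrasSlade1993, Lemma 7.3.1 (hypothesis (ii)) and (7.1.5)] -/
theorem hexSawCount_le_nine_mul_add_two (h3 : ∀ N : ℕ, hexSawCount N ≤ hexSawCount (N + 4)) (n : ℕ) :
    (hexSawCount n : ℝ) ≤ 9 * hexSawCount (n + 2) := by
  have h1 : (hexSawCount n : ℝ) ≤ hexSawCount (n + 4) := by exact_mod_cast h3 n
  have h2 := hexSawCount_add_two_le (n + 2)
  linarith

/-- **(7.3.3) on `ℍ` for all `n ≥ 1`**: Kesten's inequality (7.3.4) eventually (the body of `SAW.HV.KestenIneqHex`)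
and `1/9 ≤ c_{n+2}/c_n ≤ 9` give `c_{n+2}/c_n − B/n ≤ c_{n+4}/c_{n+2}` for every `n ≥ 1`, for some `B ≥ 5μ_ℍ²`.
[cite: MadrasSlade1993, Lemma 7.3.1, (7.3.3)–(7.3.4)] -/
theorem kesten733_hex (h3 : ∀ N : ℕ, hexSawCount N ≤ hexSawCount (N + 4))
    (hK : ∃ D : ℝ, ∀ᶠ N : ℕ in atTop,
      ((hexSawCount (N + 2) : ℝ) / hexSawCount N) ^ 2 - D / N ≤
        ((hexSawCount (N + 2) : ℝ) / hexSawCount N) * ((hexSawCount (N + 4) : ℝ) / hexSawCount (N + 2))) :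
    ∃ B : ℝ, 5 * hexConnectiveConstant ^ 2 ≤ B ∧ ∀ n : ℕ, 1 ≤ n →
      (hexSawCount (n + 2) : ℝ) / hexSawCount n - B / n ≤ (hexSawCount (n + 4) : ℝ) / hexSawCount (n + 2) := by
  set φ : ℕ → ℝ := fun n => (hexSawCount (n + 2) : ℝ) / hexSawCount n with hφdef
  have hφlo : ∀ n, (1 / 9 : ℝ) ≤ φ n := fun n => by
    simp only [hφdef]
    rw [le_div_iff₀ (by exact_mod_cast hexSawCount_pos n)]
    have := hexSawCount_le_nine_mul_add_two h3 n
    linarith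
  have hφhi : ∀ n, φ n ≤ 9 := fun n => by
    simp only [hφdef]
    rw [div_le_iff₀ (by exact_mod_cast hexSawCount_pos n)]
    exact hexSawCount_add_two_le n
  obtain ⟨D, hD⟩ := hK
  obtain ⟨N₀, hN₀⟩ := eventually_atTop.1 hD
  have hK' : ∀ n, N₀ ≤ n → φ n ^ 2 - D / n ≤ φ n * φ (n + 2) := fun n hn => by
    have := hN₀ n hn
    simp only [hφdef, show n + 2 + 2 = n + 4 by ring]
    exact this
  set B₀ : ℝ := max D 0 / (1 / 9) + 9 * N₀ with hB₀def
  have hB₀0 : 0 ≤ B₀ := by rw [hB₀def]; positivity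
  refine ⟨B₀ + 5 * hexConnectiveConstant ^ 2, by linarith, fun n hn => ?_⟩
  have h := Zd.KestenRateEnv.kesten733_of_eventually (s := 2) (by norm_num : (0 : ℝ) < 1 / 9) hφlo hφhi hK' hn
  have hn0 : (0 : ℝ) < n := by exact_mod_cast hn
  have hBB : B₀ / (n : ℝ) ≤ (B₀ + 5 * hexConnectiveConstant ^ 2) / n :=
    div_le_div_of_nonneg_right (by nlinarith) hn0.le
  simp only [hφdef, show n + 2 + 2 = n + 4 by ring] at h
  rw [← hB₀def] at h
  linarith

end HexRate

/-! ### The headlines -/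

open HexRate in
/-- **A rate in Kesten's two-step ratio limit theorem on the hexagonal lattice**: from `c_N(ℍ) ≤ c_{N+4}(ℍ)`
(K3-ℍ, face `HexPlusFour`) and Kesten's inequality (7.3.4) on `ℍ` (face `SAW.HV.KestenIneqHex`; bodies taken
verbatim as hypotheses), `∃ K, ∀ N ≥ 1, |c_{N+2}(ℍ)/c_N(ℍ) − (2 + √2)| ≤ K · N^{-1/4}` — the tree's quantitative
Lemma 7.3.1 run on the all-`n` envelope `c_n(ℍ) ≤ 24 e^{17800√n} μ_ℍ^n` and `μ_ℍ = √(2+√2)` (Duminil-Copin–Smirnov).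
Exponent `1/4` (envelope route); nothing is printed for `ℍ` (for `ℤ^d`: `N^{-1/3}`, Kesten 1963, Madras–Slade
(7.5.1)). [cite: MadrasSlade1993, §7.5 eq. (7.5.1) and Lemma 7.3.1; DuminilCopinSmirnov2012, Thm 1] -/
theorem hexRatioTwo_rate_of (h3 : ∀ N : ℕ, hexSawCount N ≤ hexSawCount (N + 4))
    (hK : ∃ D : ℝ, ∀ᶠ N : ℕ in atTop,
      ((hexSawCount (N + 2) : ℝ) / hexSawCount N) ^ 2 - D / N ≤
        ((hexSawCount (N + 2) : ℝ) / hexSawCount N) * ((hexSawCount (N + 4) : ℝ) / hexSawCount (N + 2))) :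
    ∃ K : ℝ, ∀ N : ℕ, 1 ≤ N →
      |(hexSawCount (N + 2) : ℝ) / hexSawCount N - (2 + Real.sqrt 2)| ≤ K * (N : ℝ) ^ (-(1 : ℝ) / 4) := by
  obtain ⟨-, hμ1, hsq⟩ := hexConnectiveConstant_facts
  obtain ⟨B, hB5, h733⟩ := kesten733_hex h3 hK
  have hc : ∀ n, 0 < (fun n => (hexSawCount n : ℝ)) n := fun n => by
    show (0 : ℝ) < hexSawCount n; exact_mod_cast hexSawCount_pos n
  have hhi : ∀ n, (hexSawCount n : ℝ) ≤
      Real.exp (Real.log 24 + 17800 * Real.sqrt n) * hexConnectiveConstant ^ n := fun n => by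
    rw [Real.exp_add, Real.exp_log (by norm_num)]; exact hexSawCount_le_envelope n
  have hφ5 : ∀ n, (hexSawCount (n + 2) : ℝ) ≤ 5 * hexConnectiveConstant ^ 2 * hexSawCount n := fun n => by
    have h1 := hexSawCount_add_two_le n
    have h2 : (9 : ℝ) ≤ 5 * hexConnectiveConstant ^ 2 := by rw [hsq]; have := Real.sqrt_nonneg 2; nlinarith
    have h0 : (0 : ℝ) ≤ hexSawCount n := Nat.cast_nonneg _
    nlinarith
  refine ⟨hexConnectiveConstant * Real.sqrt (12 * B * (Real.log 24 + 1 + 17800 * Real.sqrt 2)), fun N hN => ?_⟩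
  have h := Zd.KestenRateEnv.abs_ratio_sub_sq_le_rpow (c := fun n => (hexSawCount n : ℝ)) hc hμ1 hB5
    (Real.log_nonneg (by norm_num)) (by norm_num : (0 : ℝ) ≤ 17800) h733 hexConnectiveConstant_pow_le hhi hφ5 hN
  rw [hsq] at h
  exact h

open HexRate in
/-- **The mixed-exponent form** `−K N^{-1/4} ≤ c_{N+2}(ℍ)/c_N(ℍ) − (2+√2) ≤ K N^{-1/3}` (every `N ≥ 1`): the upper
side by submultiplicativity `c_{N+2M} ≤ c_N c_{2M}` at the short length (`Zd.KestenRateEnv.ratio_rate_mixed`).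
[cite: MadrasSlade1993, §7.5 eq. (7.5.1)–(7.5.2) and Lemma 7.3.1; DuminilCopinSmirnov2012, Thm 1] -/
theorem hexRatioTwo_rate_mixed_of (h3 : ∀ N : ℕ, hexSawCount N ≤ hexSawCount (N + 4))
    (hK : ∃ D : ℝ, ∀ᶠ N : ℕ in atTop,
      ((hexSawCount (N + 2) : ℝ) / hexSawCount N) ^ 2 - D / N ≤
        ((hexSawCount (N + 2) : ℝ) / hexSawCount N) * ((hexSawCount (N + 4) : ℝ) / hexSawCount (N + 2))) :
    ∃ K : ℝ, ∀ N : ℕ, 1 ≤ N →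
      -(K * (N : ℝ) ^ (-(1 : ℝ) / 4)) ≤ (hexSawCount (N + 2) : ℝ) / hexSawCount N - (2 + Real.sqrt 2) ∧
        (hexSawCount (N + 2) : ℝ) / hexSawCount N - (2 + Real.sqrt 2) ≤ K * (N : ℝ) ^ (-(1 : ℝ) / 3) := by
  obtain ⟨-, hμ1, hsq⟩ := hexConnectiveConstant_facts
  obtain ⟨B, hB5, h733⟩ := kesten733_hex h3 hK
  have hc : ∀ n, 0 < (fun n => (hexSawCount n : ℝ)) n := fun n => by
    show (0 : ℝ) < hexSawCount n; exact_mod_cast hexSawCount_pos n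
  have hφ5 : ∀ n, (hexSawCount (n + 2) : ℝ) ≤ 5 * hexConnectiveConstant ^ 2 * hexSawCount n := fun n => by
    have h1 := hexSawCount_add_two_le n
    have h2 : (9 : ℝ) ≤ 5 * hexConnectiveConstant ^ 2 := by rw [hsq]; have := Real.sqrt_nonneg 2; nlinarith
    have h0 : (0 : ℝ) ≤ hexSawCount n := Nat.cast_nonneg _
    nlinarith
  have hsub : ∀ n m : ℕ, (hexSawCount (n + m) : ℝ) ≤ hexSawCount n * hexSawCount m := fun n m => by
    exact_mod_cast hexSawCount_add_le n m
  have h := Zd.KestenRateEnv.ratio_rate_mixed (c := fun n => (hexSawCount n : ℝ)) hc hμ1 hB5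
    (by norm_num : (1 : ℝ) ≤ 24) (by norm_num : (0 : ℝ) ≤ 17800) h733 hexConnectiveConstant_pow_le
    hexSawCount_le_envelope hφ5 hsub
  rw [hsq] at h
  exact h

/-! ### Unconditional forms (K3-ℍ and Kesten's inequality on `ℍ` are tree theorems) -/

/-- **`|c_{N+2}(ℍ)/c_N(ℍ) − (2+√2)| ≤ K · N^{-1/4}` for every `N ≥ 1`, unconditionally** — `hexRatioTwo_rate_of` fed by
`hexSawCount_le_add_four` (K3-ℍ) and `HV.KestenIneqHex_holds` (the lane's HEX-RATIO-2 chain). Not in print for `ℍ`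
(exponent `1/4` as delivered by the envelope). [cite: MadrasSlade1993, §7.5 eq. (7.5.1) and Lemma 7.3.1; DuminilCopinSmirnov2012, Thm 1] -/
theorem hexRatioTwo_rate : ∃ K : ℝ, ∀ N : ℕ, 1 ≤ N →
    |(hexSawCount (N + 2) : ℝ) / hexSawCount N - (2 + Real.sqrt 2)| ≤ K * (N : ℝ) ^ (-(1 : ℝ) / 4) :=
  hexRatioTwo_rate_of hexSawCount_le_add_four HV.KestenIneqHex_holds

/-- **`−K N^{-1/4} ≤ c_{N+2}(ℍ)/c_N(ℍ) − (2+√2) ≤ K N^{-1/3}` for every `N ≥ 1`, unconditionally.**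
[cite: MadrasSlade1993, §7.5 eq. (7.5.1)–(7.5.2) and Lemma 7.3.1; DuminilCopinSmirnov2012, Thm 1] -/
theorem hexRatioTwo_rate_mixed : ∃ K : ℝ, ∀ N : ℕ, 1 ≤ N →
    -(K * (N : ℝ) ^ (-(1 : ℝ) / 4)) ≤ (hexSawCount (N + 2) : ℝ) / hexSawCount N - (2 + Real.sqrt 2) ∧
      (hexSawCount (N + 2) : ℝ) / hexSawCount N - (2 + Real.sqrt 2) ≤ K * (N : ℝ) ^ (-(1 : ℝ) / 3) :=
  hexRatioTwo_rate_mixed_of hexSawCount_le_add_four HV.KestenIneqHex_holds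

/-! ### The two-sided `N^{-1/3}` rate modulo an insertion inequality (route R72's assembly) -/

open HexRate in
/-- **`|c_{N+2}(ℍ)/c_N(ℍ) − (2+√2)| ≤ K · N^{-1/3}` modulo an insertion inequality**: if some auxiliary count `e_M`
satisfies the lower envelope `e^{-c√M} μ_ℍ^{2M} ≤ A·e_M` (`M ≥ 2`; `c ≥ 0`, `A ≥ 1`) and the insertion inequality
`c_n(ℍ)·e_M ≤ (n+1)·c_{n+2M}(ℍ)` (all `n, M`), then Kesten's printed exponent `1/3` holds on BOTH sides for `ℍ`:
the lower side by the tree's `Zd.KestenRateLower.lower_rate_cubeRoot_ins` (backward iteration of (7.3.3) against the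
inserted pieces, both parities), the upper side by `hexRatioTwo_rate_mixed_of`. (Lane route R72: `e_M` = the
brick-wall bridges of length `2M`, spliced in by reflection at the last height maximum.)
[cite: MadrasSlade1993, §7.5 eq. (7.5.1)–(7.5.2) (p. 255), Lemma 7.3.1 (p. 242), and Corollary 3.2.6 (p. 68) in the role the tree's ℤ^d proof gives to an insertion inequality; DuminilCopinSmirnov2012, Thm 1] -/
theorem hexRatioTwo_rate_cubeRoot_of (h3 : ∀ N : ℕ, hexSawCount N ≤ hexSawCount (N + 4))
    (hK : ∃ D : ℝ, ∀ᶠ N : ℕ in atTop,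
      ((hexSawCount (N + 2) : ℝ) / hexSawCount N) ^ 2 - D / N ≤
        ((hexSawCount (N + 2) : ℝ) / hexSawCount N) * ((hexSawCount (N + 4) : ℝ) / hexSawCount (N + 2)))
    {e : ℕ → ℝ} {c A : ℝ} (hc : 0 ≤ c) (hA : 1 ≤ A)
    (hlo : ∀ M : ℕ, 2 ≤ M → Real.exp (-(c * Real.sqrt M)) * hexConnectiveConstant ^ (2 * M) ≤ A * e M)
    (hIns : ∀ n M : ℕ, (hexSawCount n : ℝ) * e M ≤ (n + 1) * hexSawCount (n + 2 * M)) :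
    ∃ K : ℝ, ∀ N : ℕ, 1 ≤ N →
      |(hexSawCount (N + 2) : ℝ) / hexSawCount N - (2 + Real.sqrt 2)| ≤ K * (N : ℝ) ^ (-(1 : ℝ) / 3) := by
  obtain ⟨-, hμ1, hsq⟩ := hexConnectiveConstant_facts
  obtain ⟨B, hB5, h733⟩ := kesten733_hex h3 hK
  have hcpos : ∀ n, 0 < (fun n => (hexSawCount n : ℝ)) n := fun n => by
    show (0 : ℝ) < hexSawCount n; exact_mod_cast hexSawCount_pos n
  have hμ2 : 1 ≤ hexConnectiveConstant ^ 2 := by nlinarith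
  have hB1 : 1 ≤ B := by nlinarith
  have hBμ : hexConnectiveConstant ^ 2 ≤ B := by nlinarith
  -- the insertion inequality in the engine's polynomial shape, either parity
  have hSM : ∀ r : ℕ, ∀ N' M : ℕ, 0 ≤ N' → N' % 2 = r → 2 ≤ M →
      (fun n => (hexSawCount n : ℝ)) N' * e M ≤
        (2 * ((N' : ℝ) + 2 * M) + 3) ^ 6 * (fun n => (hexSawCount n : ℝ)) (N' + 2 * M) := by
    intro r N' M _ _ _
    have h := hIns N' M
    have hM0 : (0 : ℝ) ≤ M := Nat.cast_nonneg M
    have h1 : (N' : ℝ) + 1 ≤ 2 * ((N' : ℝ) + 2 * M) + 3 := by linarith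
    have h2 : 2 * ((N' : ℝ) + 2 * M) + 3 ≤ (2 * ((N' : ℝ) + 2 * M) + 3) ^ 6 :=
      le_self_pow₀ (by linarith) (by norm_num)
    have hc' : (0 : ℝ) ≤ hexSawCount (N' + 2 * M) := Nat.cast_nonneg _
    show (hexSawCount N' : ℝ) * e M ≤ (2 * ((N' : ℝ) + 2 * M) + 3) ^ 6 * hexSawCount (N' + 2 * M)
    exact h.trans (mul_le_mul_of_nonneg_right (h1.trans h2) hc')
  obtain ⟨K₀, hK₀⟩ := Zd.KestenRateLower.lower_rate_cubeRoot_ins (r := 0) (n₁ := 0) hcpos hμ1 hB1 hBμ hc hA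
    h733 hlo (hSM 0)
  obtain ⟨K₁, hK₁⟩ := Zd.KestenRateLower.lower_rate_cubeRoot_ins (r := 1) (n₁ := 0) hcpos hμ1 hB1 hBμ hc hA
    h733 hlo (hSM 1)
  obtain ⟨K₂, hK₂⟩ := hexRatioTwo_rate_mixed_of h3 hK
  refine ⟨max (max K₀ K₁) (max K₂ 0), fun N hN => ?_⟩
  have hr : 0 ≤ (N : ℝ) ^ (-(1 : ℝ) / 3) := Real.rpow_nonneg (Nat.cast_nonneg N) _
  set φ := (hexSawCount (N + 2) : ℝ) / hexSawCount N with hφ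
  rw [abs_le]
  constructor
  · -- lower side
    rcases le_or_gt (2 + Real.sqrt 2) φ with hge | hlt
    · have : 0 ≤ max (max K₀ K₁) (max K₂ 0) * (N : ℝ) ^ (-(1 : ℝ) / 3) :=
        mul_nonneg ((le_max_right _ _).trans (le_max_right _ _)) hr
      linarith
    · set u := 2 + Real.sqrt 2 - φ with hu
      have hu0 : 0 < u := by rw [hu]; linarith
      have hdev : (fun n => (hexSawCount n : ℝ)) (N + 2) / (fun n => (hexSawCount n : ℝ)) N ≤
          hexConnectiveConstant ^ 2 - u := by
        show (hexSawCount (N + 2) : ℝ) / hexSawCount N ≤ hexConnectiveConstant ^ 2 - u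
        rw [hsq, hu]; linarith
      rcases Nat.mod_two_eq_zero_or_one N with hpar | hpar
      · have h1 := hK₀ N (by omega) hpar u hu0 hdev
        have h2 : K₀ * (N : ℝ) ^ (-(1 : ℝ) / 3) ≤ max (max K₀ K₁) (max K₂ 0) * (N : ℝ) ^ (-(1 : ℝ) / 3) :=
          mul_le_mul_of_nonneg_right ((le_max_left _ _).trans (le_max_left _ _)) hr
        linarith
      · have h1 := hK₁ N (by omega) hpar u hu0 hdev
        have h2 : K₁ * (N : ℝ) ^ (-(1 : ℝ) / 3) ≤ max (max K₀ K₁) (max K₂ 0) * (N : ℝ) ^ (-(1 : ℝ) / 3) :=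
          mul_le_mul_of_nonneg_right ((le_max_right _ _).trans (le_max_left _ _)) hr
        linarith
  · -- upper side (submultiplicativity, `hexRatioTwo_rate_mixed_of`)
    have h1 := (hK₂ N hN).2
    have h2 : K₂ * (N : ℝ) ^ (-(1 : ℝ) / 3) ≤ max (max K₀ K₁) (max K₂ 0) * (N : ℝ) ^ (-(1 : ℝ) / 3) :=
      mul_le_mul_of_nonneg_right ((le_max_left _ _).trans (le_max_right _ _)) hr
    linarith

end Literature.Probability.RandomPlanarGeometry.SAW
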